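import Mathlib
import Literature.Computability.AlgebraicComplexity.WordPolynomialRank
import Literature.Computability.AlgebraicComplexity.IMMInVPProofs
import Literature.Computability.AlgebraicComplexity.ArithCircuitProofs

/-!
# Route BarrierLever — crux `DefinableEquations` (stmt-8745) / item `SingleSizeEquations`
# (stmt-8749): SPARSE LAYERED AUTOMATA ARE CHEAP — engine for the LST method wall at `b = 2`
# (val-np-p5 g15, part 1 of `…ProductDepthWallTwo*`)

For ANY layered automaton of the tree (`LayeredAutomaton`: states `St t`, letters `In t`, partial
transitions `step`), the accepted-word polynomial `∑_{w accepted} ∏_t X⟨t, w t⟩` has complexity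
at most TWICE THE NUMBER OF TRANSITIONS `∑_t ∑_s #{b : step t s b ≠ none}`
(`complexity_acceptedPoly_le`).  Proof: the generating polynomials of the runs (`statePoly`, the
ABP values; recursion `statePoly_succ`) are packed into one polynomial per layer with a
placeholder variable per state (`layerPoly`), consecutive layers differ by ONE substitution
(`layerSubst`, `aeval_layerSubst_layerPoly`) costing one product and one sum per transition
(`complexity_layerSubst_inr_le`), and Bürgisser's substitution bound `complexity_aeval_le`
threads the chain (`complexity_layerPoly_le`).  The tree's `aeval_autSubst_immPoly` prices the
same automaton as a projection of the DENSE `IMM_{n,d}` (`2n³d`); this file is the sparse count.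

What this is NOT: nothing here touches the crux (b = 2 OPEN, Chatterjee–Tengse arXiv:2309.07612
§1.3 dir. 2) or `VP ≠ VNP`; no named facts, standard axioms.  The `def`s are the explicit
intermediate polynomials / counts of the dynamic programme.
Refs: Limaye–Srinivasan–Tavenas, J. ACM 72 (2025) Art. 26, Lemma 22; Bürgisser 2000, Rem. 2.7.
-/

-- `Summit.ValiantsHypothesis.ValiantsHypothesis.…` repeats a component (D-0017 layout); mandated.
set_option linter.dupNamespace false

noncomputable section

namespace Summit.ValiantsHypothesis.ValiantsHypothesis.Theorems.BarrierLeverDefinableEquations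

open MvPolynomial
open Literature.Computability.AlgebraicComplexity
open Literature.Computability.AlgebraicComplexity.LSTWord
open scoped BigOperators

namespace ProductDepthWallTwo

section Engine

variable {K : Type*} [CommSemiring K]
variable {d : ℕ} {St : ℕ → Type} [∀ t, Fintype (St t)] [∀ t, DecidableEq (St t)]
variable {In : Fin d → Type} [∀ t, Fintype (In t)] [∀ t, DecidableEq (In t)]
  [∀ t, Inhabited (In t)]
variable (start : St 0) (step : (t : Fin d) → St t → In t → Option (St (t.val + 1)))

/-- The generating polynomial of the runs of length `t` ending in the state `s`:
`∑_{w : prefixes of length t} [run t w = some s] ∏_{i<t} X ⟨i, w i⟩` (the polynomial computed at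
the vertex `v_τ` of layer `t` of the ABP, LST 2025, proof of Lemma 22).
[cite: LimayeSrinivasanTavenas2025, Lemma 22] -/
def statePoly (t : ℕ) (s : St t) : MvPolynomial (Σ t : Fin d, In t) K :=
  ∑ w ∈ LayeredAutomaton.prefixWords (In := In) t,
    if LayeredAutomaton.run start step w t = some s then
      LayeredAutomaton.prefixMono (K := K) t w else 0

/-- The number of transitions out of the state `s` at layer `t`. [folklore] -/
def outDeg (t : Fin d) (s : St t) : ℕ :=
  (Finset.univ.filter fun b : In t => (step t s b).isSome).card

/-- The number of transitions at layer `t`. [folklore] -/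
def edges (t : Fin d) : ℕ := ∑ s : St t, outDeg step t s

omit [∀ t, Fintype (St t)] [∀ t, DecidableEq (St t)] in
/-- The only prefix of length `0` is the default word. [folklore] -/
theorem prefixWords_zero :
    LayeredAutomaton.prefixWords (In := In) 0 = {fun _ => default} := by
  ext w
  simp only [LayeredAutomaton.prefixWords, Finset.mem_filter, Finset.mem_univ, true_and, zero_le,
    forall_const, Finset.mem_singleton]
  exact ⟨fun h => funext h, fun h i => by rw [h]⟩

omit [∀ t, Fintype (St t)] [∀ t, DecidableEq (St t)] [∀ t, Fintype (In t)] [∀ t, DecidableEq (In t)]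
  [∀ t, Inhabited (In t)] in
/-- The monomial of the empty prefix is `1`. [folklore] -/
theorem prefixMono_zero (w : (i : Fin d) → In i) :
    LayeredAutomaton.prefixMono (K := K) 0 w = 1 := by
  unfold LayeredAutomaton.prefixMono
  refine Finset.prod_eq_one fun i hi => ?_
  simp at hi

omit [∀ t, Fintype (St t)] in
/-- At layer `0` the only run is the empty one, in the start state. [folklore] -/
theorem statePoly_zero (s : St 0) :
    statePoly (K := K) start step 0 s = if start = s then 1 else 0 := by
  unfold statePoly
  rw [prefixWords_zero, Finset.sum_singleton, prefixMono_zero]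
  have hrun : LayeredAutomaton.run start step (fun i : Fin d => (default : In i)) 0 = some start := rfl
  by_cases h : start = s
  · rw [hrun, if_pos (congrArg some h), if_pos h]
  · rw [hrun, if_neg (fun h' => h (Option.some.inj h')), if_neg h]

/-- **One layer**: `statePoly (t+1) s' = ∑_s statePoly t s · ∑_{b : step t s b = some s'} X⟨t,b⟩`
(the recursion of the ABP; cf. tree `LayeredAutomaton.sum_runPoly_mul_trans`).
[cite: LimayeSrinivasanTavenas2025, Lemma 22] -/
theorem statePoly_succ {t : ℕ} (ht : t < d) (s' : St (t + 1)) :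
    statePoly (K := K) start step (t + 1) s' =
      ∑ s : St t, statePoly (K := K) start step t s *
        ∑ b : In ⟨t, ht⟩, if step ⟨t, ht⟩ s b = some s' then X ⟨⟨t, ht⟩, b⟩ else 0 := by
  classical
  set H : ((i : Fin d) → In i) → MvPolynomial (Σ t : Fin d, In t) K := fun w' =>
    if LayeredAutomaton.run start step w' (t + 1) = some s' then
      LayeredAutomaton.prefixMono (K := K) (t + 1) w' else 0 with hH
  have step1 : ∀ w ∈ LayeredAutomaton.prefixWords (In := In) t,
      (∑ s : St t, (if LayeredAutomaton.run start step w t = some s then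
          LayeredAutomaton.prefixMono (K := K) t w else 0) *
        ∑ b : In ⟨t, ht⟩, (if step ⟨t, ht⟩ s b = some s' then X ⟨⟨t, ht⟩, b⟩ else 0)) =
      ∑ b : In ⟨t, ht⟩, H (Function.update w ⟨t, ht⟩ b) := by
    intro w _
    have hrun : ∀ b : In ⟨t, ht⟩,
        LayeredAutomaton.run start step (Function.update w ⟨t, ht⟩ b) (t + 1) =
          (LayeredAutomaton.run start step w t).bind fun s => step ⟨t, ht⟩ s b := fun b => by
      rw [LayeredAutomaton.run_succ start step _ t ht]
      simp only [Function.update_self]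
      rw [LayeredAutomaton.run_congr start step t (fun i hi => Function.update_of_ne
          (fun h => by subst h; simp at hi) _ _)]
    cases hr : LayeredAutomaton.run start step w t with
    | none =>
      have h0 : ∀ b : In ⟨t, ht⟩, H (Function.update w ⟨t, ht⟩ b) = 0 := fun b => by
        simp only [hH, hrun b, hr, Option.bind_none]
        rw [if_neg (by simp)]
      simp only [h0, Finset.sum_const_zero]
      refine Finset.sum_eq_zero fun s _ => ?_
      rw [if_neg (by simp), zero_mul]
    | some s =>
      rw [Finset.sum_eq_single s]
      · rw [if_pos rfl, Finset.mul_sum]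
        refine Finset.sum_congr rfl fun b _ => ?_
        simp only [hH, hrun b, hr, Option.bind_some, LayeredAutomaton.prefixMono_succ_update]
        by_cases hq : step ⟨t, ht⟩ s b = some s'
        · rw [if_pos hq, if_pos hq]
        · rw [if_neg hq, if_neg hq, mul_zero]
      · exact fun s₁ _ hne => by rw [if_neg (fun h => hne (Option.some.inj h).symm), zero_mul]
      · exact fun h => absurd (Finset.mem_univ _) h
  unfold statePoly
  simp_rw [Finset.sum_mul]
  rw [Finset.sum_comm, Finset.sum_congr rfl step1]
  rw [← Finset.sum_product' (f := fun w b => H (Function.update w ⟨t, ht⟩ b))]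
  symm
  refine Finset.sum_nbij' (fun p => Function.update p.1 ⟨t, ht⟩ p.2)
    (fun w' => (Function.update w' ⟨t, ht⟩ default, w' ⟨t, ht⟩)) ?_ ?_ ?_ ?_ ?_
  · rintro ⟨w, b⟩ hp
    exact LayeredAutomaton.update_mem_prefixWords ht (Finset.mem_product.1 hp).1 b
  · intro w' hw'
    exact Finset.mem_product.2
      ⟨LayeredAutomaton.update_default_mem_prefixWords ht hw', Finset.mem_univ _⟩
  · rintro ⟨w, b⟩ hp
    have hw := (Finset.mem_product.1 hp).1
    simp only [LayeredAutomaton.prefixWords, Finset.mem_filter, Finset.mem_univ, true_and] at hw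
    refine Prod.ext ?_ (by simp)
    simpa only [Function.update_idem, Function.update_eq_self_iff] using (hw _ le_rfl).symm
  · intro w' _; simp
  · intro p _; rfl

/-- The polynomial of layer `t` with PLACEHOLDERS: `Ψ_t = ∑_s statePoly t s · Y_s` in the block
variables and one extra variable `Y_s` per state of layer `t` (the vector of ABP values at layer
`t`, packed into one polynomial so that Bürgisser's substitution bound threads it).
[cite: Burgisser2000, Rem. 2.7] -/
def layerPoly (t : ℕ) : MvPolynomial ((Σ t : Fin d, In t) ⊕ St t) K :=
  ∑ s : St t, rename Sum.inl (statePoly (K := K) start step t s) * X (Sum.inr s)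

/-- The term of one transition: `X⟨t,b⟩ · Y_{s'}` if the transition leads to `s'`, else `0`.
[folklore] -/
def edgeTerm (t : Fin d) (b : In t) :
    Option (St (t.val + 1)) → MvPolynomial ((Σ t : Fin d, In t) ⊕ St (t.val + 1)) K
  | none => 0
  | some s' => X (Sum.inl ⟨t, b⟩) * X (Sum.inr s')

/-- **The layer substitution**: block variables stay, and the placeholder `Y_s` of layer `t`
becomes `∑_{b : step t s b = some s'} X⟨t,b⟩ · Y_{s'}` — one product per transition.
[cite: Burgisser2000, Rem. 2.7] -/
def layerSubst (t : Fin d) :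
    (Σ t : Fin d, In t) ⊕ St t → MvPolynomial ((Σ t : Fin d, In t) ⊕ St (t.val + 1)) K :=
  Sum.elim (fun v => X (Sum.inl v)) fun s =>
    ∑ b ∈ Finset.univ.filter (fun b : In t => (step t s b).isSome), edgeTerm (K := K) t b (step t s b)

omit [∀ t, Fintype (In t)] [∀ t, DecidableEq (In t)] [∀ t, Inhabited (In t)] in
/-- The transition term as a sum over target states. [folklore] -/
theorem edgeTerm_eq_sum (t : Fin d) (b : In t) (o : Option (St (t.val + 1))) :
    edgeTerm (K := K) t b o =
      ∑ s' : St (t.val + 1), if o = some s' then X (Sum.inl ⟨t, b⟩) * X (Sum.inr s') else 0 := by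
  cases o with
  | none => simp [edgeTerm]
  | some s₀ =>
    rw [edgeTerm, Finset.sum_eq_single s₀, if_pos rfl]
    · exact fun s' _ hne => by rw [if_neg (fun h => hne (Option.some.inj h).symm)]
    · exact fun h => absurd (Finset.mem_univ _) h

omit [∀ t, DecidableEq (In t)] [∀ t, Inhabited (In t)] in
/-- The placeholder part of the layer substitution as a full double sum. [folklore] -/
theorem layerSubst_inr (t : Fin d) (s : St t) :
    layerSubst (K := K) step t (Sum.inr s) =
      ∑ s' : St (t.val + 1), (∑ b : In t,
        if step t s b = some s' then (X (Sum.inl ⟨t, b⟩) : MvPolynomial _ K) else 0) *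
          X (Sum.inr s') := by
  unfold layerSubst
  simp only [Sum.elim_inr]
  rw [Finset.sum_filter_of_ne (fun b _ hb => by
    cases h : step t s b with
    | none => simp [edgeTerm, h] at hb
    | some _ => simp)]
  simp_rw [edgeTerm_eq_sum, Finset.sum_mul]
  rw [Finset.sum_comm]
  refine Finset.sum_congr rfl fun s' _ => Finset.sum_congr rfl fun b _ => ?_
  split_ifs <;> simp

omit [∀ t, Fintype (St t)] [∀ t, DecidableEq (St t)] [∀ t, Fintype (In t)] [∀ t, DecidableEq (In t)]
  [∀ t, Inhabited (In t)] in
/-- Substituting `X ∘ f` is renaming along `f`. [folklore] -/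
theorem aeval_X_comp {σ τ : Type*} (f : σ → τ) (p : MvPolynomial σ K) :
    aeval (fun v => (X (f v) : MvPolynomial τ K)) p = rename f p := by
  induction p using MvPolynomial.induction_on with
  | C a => simp | add p q hp hq => simp only [map_add, hp, hq]
  | mul_X p v hp => simp only [map_mul, hp, aeval_X, rename_X]

/-- **The chain**: `Ψ_{t+1} = Ψ_t ∘ layerSubst t`. [cite: Burgisser2000, Rem. 2.7] -/
theorem aeval_layerSubst_layerPoly {t : ℕ} (ht : t < d) :
    aeval (layerSubst (K := K) step ⟨t, ht⟩) (layerPoly (K := K) start step t) =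
      layerPoly (K := K) start step (t + 1) := by
  classical
  set g := layerSubst (K := K) step ⟨t, ht⟩ with hg
  -- the transition forms `T s s' = ∑_{b : step t s b = some s'} X⟨t,b⟩`
  set T : St t → St (t + 1) → MvPolynomial (Σ t : Fin d, In t) K := fun s s' =>
    ∑ b : In ⟨t, ht⟩, if step ⟨t, ht⟩ s b = some s' then X ⟨⟨t, ht⟩, b⟩ else 0 with hT
  have hcomp : g ∘ Sum.inl = fun v => X (Sum.inl v) := rfl
  have hinl : ∀ p : MvPolynomial (Σ t : Fin d, In t) K,
      aeval g (rename Sum.inl p) = rename Sum.inl p := fun p => by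
    rw [aeval_rename, hcomp, aeval_X_comp]
  have hinr : ∀ s : St t, g (Sum.inr s) =
      ∑ s' : St (t + 1), rename Sum.inl (T s s') * X (Sum.inr s') := by
    intro s
    rw [hg, layerSubst_inr]
    refine Finset.sum_congr rfl fun s' _ => ?_
    congr 1
    rw [hT, map_sum]
    refine Finset.sum_congr rfl fun b _ => ?_
    split_ifs <;> simp
  have hstep : ∀ s' : St (t + 1), ∑ s : St t,
      (rename Sum.inl (statePoly (K := K) start step t s) : MvPolynomial (_ ⊕ St (t + 1)) K) *
      rename Sum.inl (T s s') = rename Sum.inl (statePoly (K := K) start step (t + 1) s') := by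
    intro s'
    rw [statePoly_succ start step ht s', map_sum]
    refine Finset.sum_congr rfl fun s _ => ?_
    rw [← map_mul]
  calc aeval g (layerPoly (K := K) start step t)
      = ∑ s : St t, rename Sum.inl (statePoly (K := K) start step t s) * g (Sum.inr s) := by
        unfold layerPoly
        rw [map_sum]
        refine Finset.sum_congr rfl fun s _ => ?_
        rw [map_mul, hinl, aeval_X]
    _ = ∑ s : St t, ∑ s' : St (t + 1), rename Sum.inl (statePoly (K := K) start step t s) *
          rename Sum.inl (T s s') * X (Sum.inr s') := by
        refine Finset.sum_congr rfl fun s _ => ?_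
        rw [hinr, Finset.mul_sum]
        refine Finset.sum_congr rfl fun s' _ => ?_
        rw [mul_assoc]
    _ = ∑ s' : St (t + 1), ∑ s : St t, rename Sum.inl (statePoly (K := K) start step t s) *
          rename Sum.inl (T s s') * X (Sum.inr s') := Finset.sum_comm
    _ = layerPoly (K := K) start step (t + 1) := by
        unfold layerPoly
        refine Finset.sum_congr rfl fun s' _ => ?_
        rw [← Finset.sum_mul, hstep]

/-- `Ψ_0 = Y_{start}`. [folklore] -/
theorem layerPoly_zero : layerPoly (K := K) start step 0 = X (Sum.inr start) := by
  classical
  unfold layerPoly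
  rw [Finset.sum_eq_single start]
  · rw [statePoly_zero, if_pos rfl, map_one, one_mul]
  · exact fun s _ hne => by rw [statePoly_zero, if_neg (Ne.symm hne), map_zero, zero_mul]
  · exact fun h => absurd (Finset.mem_univ _) h

omit [∀ t, Fintype (St t)] [∀ t, DecidableEq (St t)] [∀ t, DecidableEq (In t)]
  [∀ t, Inhabited (In t)] in
/-- Cost of one placeholder substitution: `≤ 2 · outDeg` (one product per transition, one sum
per transition). [cite: Burgisser2000, §2.1] -/
theorem complexity_layerSubst_inr_le (t : Fin d) (s : St t) :
    complexity (layerSubst (K := K) step t (Sum.inr s)) ≤ 2 * outDeg step t s := by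
  classical
  unfold layerSubst outDeg
  simp only [Sum.elim_inr]
  set F := Finset.univ.filter fun b : In t => (step t s b).isSome with hF
  refine (complexity_finset_sum_le _ _).trans ?_
  have h1 : ∑ b ∈ F, complexity (edgeTerm (K := K) t b (step t s b)) ≤ F.card := by
    calc ∑ b ∈ F, complexity (edgeTerm (K := K) t b (step t s b)) ≤ F.card • 1 :=
          Finset.sum_le_card_nsmul _ _ _ fun b hb => by
            rw [hF, Finset.mem_filter] at hb
            obtain ⟨s', hs'⟩ := Option.isSome_iff_exists.1 hb.2
            rw [hs', edgeTerm]
            refine (complexity_mul_le_holds _ _).trans ?_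
            rw [complexity_X_holds, complexity_X_holds]
      _ = F.card := by simp
  omega

/-- **Cost of the chain**: `L(Ψ_t) ≤ 2 ∑_{t' < t} edges t'`. [cite: Burgisser2000, Rem. 2.7] -/
theorem complexity_layerPoly_le (t : ℕ) (ht : t ≤ d) :
    complexity (layerPoly (K := K) start step t) ≤
      2 * ∑ t' ∈ Finset.univ.filter (fun t' : Fin d => (t' : ℕ) < t), edges step t' := by
  classical
  induction t with
  | zero =>
    rw [layerPoly_zero, complexity_X_holds]
    exact Nat.zero_le _
  | succ t ih =>
    have ht' : t < d := Nat.lt_of_succ_le ht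
    have ih' := ih ht'.le
    have hsplit : (Finset.univ.filter fun t' : Fin d => (t' : ℕ) < t + 1) =
        insert ⟨t, ht'⟩ (Finset.univ.filter fun t' : Fin d => (t' : ℕ) < t) := by
      ext i
      simp only [Finset.mem_filter, Finset.mem_univ, true_and, Finset.mem_insert, Fin.ext_iff]
      omega
    have hnot : (⟨t, ht'⟩ : Fin d) ∉ (Finset.univ.filter fun t' : Fin d => (t' : ℕ) < t) := by
      simp
    have hsubst : ∑ v : (Σ t : Fin d, In t) ⊕ St t,
        complexity (layerSubst (K := K) step ⟨t, ht'⟩ v) ≤ 2 * edges step ⟨t, ht'⟩ := by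
      rw [Fintype.sum_sum_type]
      have h1 : ∑ v : (Σ t : Fin d, In t),
          complexity (layerSubst (K := K) step ⟨t, ht'⟩ (Sum.inl v)) = 0 :=
        Finset.sum_eq_zero fun v _ => complexity_X_holds _
      rw [h1, zero_add]
      calc ∑ s : St t, complexity (layerSubst (K := K) step ⟨t, ht'⟩ (Sum.inr s))
          ≤ ∑ s : St t, 2 * outDeg step ⟨t, ht'⟩ s :=
            Finset.sum_le_sum fun s _ => complexity_layerSubst_inr_le (K := K) step ⟨t, ht'⟩ s
        _ = 2 * edges step ⟨t, ht'⟩ := by rw [edges, Finset.mul_sum]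
    have heq : layerPoly (K := K) start step (t + 1) =
        aeval (layerSubst (K := K) step ⟨t, ht'⟩) (layerPoly (K := K) start step t) :=
      (aeval_layerSubst_layerPoly start step ht').symm
    have hsum : 2 * ∑ t' ∈ Finset.univ.filter (fun t' : Fin d => (t' : ℕ) < t + 1), edges step t' =
        2 * ∑ t' ∈ Finset.univ.filter (fun t' : Fin d => (t' : ℕ) < t), edges step t' +
          2 * edges step ⟨t, ht'⟩ := by
      rw [hsplit, Finset.sum_insert hnot]
      ring
    rw [hsum, heq]
    exact (complexity_aeval_le _ _).trans (Nat.add_le_add ih' hsubst)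

/-- The accepted-word polynomial is `Ψ_d` with every placeholder set to `1`. [folklore] -/
theorem aeval_layerPoly_d :
    aeval (Sum.elim X fun _ => (1 : MvPolynomial (Σ t : Fin d, In t) K))
        (layerPoly (K := K) start step d) =
      ∑ w : (t : Fin d) → In t,
        if LayeredAutomaton.Accepts start step w then ∏ t : Fin d, X ⟨t, w t⟩ else 0 := by
  classical
  unfold layerPoly
  rw [map_sum]
  simp only [map_mul, aeval_X, Sum.elim_inr, mul_one, aeval_rename]
  have hcomp : (Sum.elim X fun _ : St d => (1 : MvPolynomial (Σ t : Fin d, In t) K)) ∘ Sum.inl =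
      X := rfl
  have hinl : ∀ s : St d, aeval ((Sum.elim X fun _ : St d =>
      (1 : MvPolynomial (Σ t : Fin d, In t) K)) ∘ Sum.inl) (statePoly (K := K) start step d s) =
        statePoly (K := K) start step d s := by
    intro s
    rw [hcomp]
    exact aeval_X_left_apply _
  simp_rw [hinl]
  unfold statePoly
  rw [Finset.sum_comm, LayeredAutomaton.prefixWords_eq_univ le_rfl]
  refine Finset.sum_congr rfl fun w _ => ?_
  rw [LayeredAutomaton.prefixMono_eq_prod le_rfl]
  by_cases hacc : LayeredAutomaton.Accepts start step w
  · obtain ⟨s, hs⟩ := (LayeredAutomaton.accepts_iff start step w).1 hacc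
    rw [if_pos hacc, Finset.sum_eq_single s]
    · rw [if_pos hs]
    · exact fun s₁ _ hne => by rw [if_neg (hs ▸ fun h => hne (Option.some.inj h).symm)]
    · exact fun h => absurd (Finset.mem_univ _) h
  · rw [if_neg hacc]
    exact Finset.sum_eq_zero fun s _ =>
      if_neg fun h => hacc ((LayeredAutomaton.accepts_iff start step w).2 ⟨s, h⟩)

/-- **Sparse layered automata are cheap**: the accepted-word polynomial
`∑_{w accepted} ∏_t X⟨t, w t⟩` has complexity at most twice the number of transitions
`∑_t ∑_s #{b : step t s b ≠ none}` (every intermediate result of the dynamic programme is free,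
Bürgisser 2000, Rem. 2.7). [cite: Burgisser2000, Rem. 2.7] -/
theorem complexity_acceptedPoly_le :
    complexity (∑ w : (t : Fin d) → In t,
        if LayeredAutomaton.Accepts start step w then
          (∏ t : Fin d, X ⟨t, w t⟩ : MvPolynomial (Σ t : Fin d, In t) K) else 0) ≤
      2 * ∑ t : Fin d, edges step t := by
  classical
  rw [← aeval_layerPoly_d start step]
  refine (complexity_aeval_le _ _).trans ?_
  have h0 : ∑ v : (Σ t : Fin d, In t) ⊕ St d,
      complexity ((Sum.elim X fun _ => (1 : MvPolynomial (Σ t : Fin d, In t) K)) v) = 0 := by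
    refine Finset.sum_eq_zero ?_
    rintro (v | s) -
    · exact complexity_X_holds _
    · simpa using complexity_C_holds (σ := (Σ t : Fin d, In t)) (1 : K)
  rw [h0, add_zero]
  refine (complexity_layerPoly_le start step d le_rfl).trans ?_
  refine Nat.mul_le_mul_left _ (le_of_eq (Finset.sum_congr ?_ fun _ _ => rfl))
  ext t; simp

end Engine

end ProductDepthWallTwo

end Summit.ValiantsHypothesis.ValiantsHypothesis.Theorems.BarrierLeverDefinableEquations
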